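import Literature.NumberTheory.BeurlingPrimes.BDRTemplate
import Literature.NumberTheory.BeurlingPrimes.BVRiemannCount
import Mathlib.NumberTheory.Harmonic.Bounds
import HarnessLib

/-!
# BDR 2023, Theorem 3.2: `Π_𝒫 = G + O(log log x)` and `ψ_𝒫(x) = x + Σ_ω x^ω/ω − Σ_ρ x^ρ/ρ + O(x^δ)`

Topic `Literature/NumberTheory/BeurlingPrimes`, grouping namespace `BDR`. Everything in this file is PROVED.

Broucke–Debruyne–Révész (2023), proof of Theorem 3.2, first assertion: from `|π_𝒫 − F| ≤ 2` for the template
`F = li + Σ_ω li(x^ω) − Σ_ρ li(x^ρ) + M li(x^δ)` (`BDRTemplate.lean`),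
"`Π_𝒫(x) = Σ_{k ≤ log x/log p₁} (1/k)(F(x^{1/k}) + O(1)) = … = G(x) + O(log log x)`" ((3.2), with
`G(x) = Σ_k F(x^{1/k})/k = Li(x) + Σ_ω Li(x^ω) − Σ_ρ Li(x^ρ) + M Li(x^δ)`, (3.3)), and
"Since `ψ_𝒫(x) := ∫_1^x log u dΠ_𝒫(u)`, here we compute `∫_1^x log u dLi(u^z) = (x^z − 1)/z − log x`, resulting in
`ψ_𝒫(x) = x + Σ_ω x^ω/ω − Σ_ρ x^ρ/ρ + M x^δ/δ + O(log x log log x)`, which in particular demonstrates the first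
assertion." Here:

* `Adm.abs_riemannPrimeCount_sub_G_le`, `Adm.exists_abs_riemannPrimeCount_sub_G_le` — if `|π_P(y) − F(y)| ≤ A'`
  (`y ≥ 1`) then `|Π_P(x) − G(x)| ≤ C log log x` (`x ≥ 3`); verbatim the tree's argument for `li`/`Li`
  (`BVRiemannCount.lean`) with `Σ_k F(x^{1/k})/k = G(x)` (`BDRTemplate.hasSum_F_rpow_div`);
* `Adm.G_mul_log_sub_integral` — `∫₁ˣ log u dG(u) = G(x) log x − ∫₁ˣ G(u) du/u
   = (x − 1 − log x) + Σ_ω ((x^ω−1)/ω − log x) − Σ_ρ ((x^ρ−1)/ρ − log x) + M((x^δ−1)/δ − log x)`;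
* `Adm.exists_abs_chebyshevPsi_sub_le` — **the first assertion of Theorem 3.2**: there is `C` with
  `|ψ_P(x) − (x + Σ_ω x^ω/ω − Σ_ρ x^ρ/ρ)| ≤ C x^δ` for all `x ≥ 1`.

## References
* [BrouckeDebruyneRevesz2023] F. Broucke, G. Debruyne, Sz. Gy. Révész, *Some examples of well-behaved Beurling
  number systems*, arXiv:2309.01567, proof of Theorem 3.2 ((3.2)–(3.3) and the display for `ψ_𝒫`) (read, p. 8).
-/

noncomputable section

open Complex Set Filter MeasureTheory intervalIntegral Real
open scoped Topology Nat

namespace Literature.NumberTheory.BeurlingPrimes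

open Literature.Barriers.RiemannHypothesis

namespace BDR

/-! ### `Π_P − G = O(log log x)` -/

/-- The casted harmonic number bound `Σ_{k<N} 1/(k+1) ≤ 1 + log N` (Mathlib's `harmonic_le_one_add_log`; private
copy of a folklore bound, as in `BVRiemannCount.lean`). [folklore] -/
private theorem sum_range_inv_le_log' (N : ℕ) : ∑ k ∈ Finset.range N, 1 / ((k : ℝ) + 1) ≤ 1 + Real.log N := by
  have h := harmonic_le_one_add_log N
  have hcast : ((harmonic N : ℚ) : ℝ) = ∑ k ∈ Finset.range N, 1 / ((k : ℝ) + 1) := by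
    simp [harmonic, one_div]
  linarith [hcast]

variable {R S : Finset ℝ} {δ : ℝ} {M : ℕ} (h : Adm R S δ M) (P : BeurlingPrimes)
include h

/-- `F(y) ≤ W y log y` for `y ≥ 1` (`F ≤ W li ≤ W Li ≤ W(y − 1) ≤ W y log y`). [folklore] -/
theorem Adm.F_le_mul_log {y : ℝ} (hy : 1 ≤ y) : F R S δ M y ≤ wBound R S M * (y * Real.log y) :=
  (h.F_le y).trans (mul_le_mul_of_nonneg_left
    ((li_le_Li hy).trans ((Li_le_sub_one hy).trans (sub_one_le_mul_log hy))) wBound_pos.le)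

/-- **`π_P = F + O(1)` implies `Π_P = G + O(log log x)`**: if `|π_P(y) − F(y)| ≤ A'` for all `y ≥ 1`, then for
all `x ≥ 3`, `|Π_P(x) − G(x)| ≤ A'(1 + log log x + |log log λ₀|) + 2W λ₀ log λ₀`
(the terms `k ≤ log x/log λ₀` and the tail, exactly as for `li`/`Li`).
[cite: BrouckeDebruyneRevesz2023, proof of Theorem 3.2 (3.2)] -/
theorem Adm.abs_riemannPrimeCount_sub_G_le {A' : ℝ}
    (hπ : ∀ y : ℝ, 1 ≤ y → |(P.primeCount y : ℝ) - F R S δ M y| ≤ A') {x : ℝ} (hx : 3 ≤ x) :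
    |P.riemannPrimeCount x - G R S δ M x| ≤
      A' * (1 + Real.log (Real.log x) + |Real.log (Real.log (P.prime 0))|) +
        2 * wBound R S M * P.prime 0 * Real.log (P.prime 0) := by
  have hx1 : 1 ≤ x := by linarith
  have hx0 : 0 < x := by linarith
  have hW := wBound_pos (R := R) (S := S) (M := M)
  have hA' : 0 ≤ A' := le_trans (abs_nonneg _) (hπ 1 le_rfl)
  have hp0 : 1 < P.prime 0 := P.one_lt
  have hlp : 0 < Real.log (P.prime 0) := Real.log_pos hp0
  have hlx : 1 < Real.log x := by
    rw [Real.lt_log_iff_exp_lt hx0]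
    exact lt_of_lt_of_le (by have := Real.exp_one_lt_d9; linarith) hx
  have hllx : 0 ≤ Real.log (Real.log x) := Real.log_nonneg hlx.le
  set y : ℕ → ℝ := fun k ↦ x ^ (1 / ((k : ℝ) + 1)) with hydef
  have hy1 : ∀ k, 1 ≤ y k := fun k ↦ Real.one_le_rpow hx1 (by positivity)
  have hlogy : ∀ k, Real.log (y k) = Real.log x / ((k : ℝ) + 1) := by
    intro k; rw [hydef]; simp only; rw [Real.log_rpow hx0]; ring
  set d : ℕ → ℝ := fun k ↦ ((P.primeCount (y k) : ℝ) - F R S δ M (y k)) / ((k : ℝ) + 1) with hddef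
  have hd : HasSum d (P.riemannPrimeCount x - G R S δ M x) := by
    have h1 := (hasSum_primeCount_rpow_div P hx0.le).sub (h.hasSum_F_rpow_div hx1)
    refine h1.congr_fun fun k ↦ ?_
    simp only [hddef, hydef]; ring
  set N : ℕ := ⌊Real.log x / Real.log (P.prime 0)⌋₊ with hN
  have hNle : (N : ℝ) ≤ Real.log x / Real.log (P.prime 0) := Nat.floor_le (div_nonneg (by linarith) hlp.le)
  have hNlt : Real.log x / Real.log (P.prime 0) < (N : ℝ) + 1 := Nat.lt_floor_add_one _
  -- head
  have hhead : |∑ k ∈ Finset.range N, d k| ≤ A' * (1 + Real.log (Real.log x) + |Real.log (Real.log (P.prime 0))|) := by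
    have h1 : |∑ k ∈ Finset.range N, d k| ≤ ∑ k ∈ Finset.range N, A' * (1 / ((k : ℝ) + 1)) := by
      refine (Finset.abs_sum_le_sum_abs _ _).trans (Finset.sum_le_sum fun k _ ↦ ?_)
      simp only [hddef, abs_div, abs_of_pos (by positivity : (0 : ℝ) < k + 1)]
      rw [mul_one_div]
      exact div_le_div_of_nonneg_right (hπ (y k) (hy1 k)) (by positivity)
    rw [← Finset.mul_sum] at h1
    refine h1.trans (mul_le_mul_of_nonneg_left ?_ hA')
    refine (sum_range_inv_le_log' N).trans ?_
    rcases Nat.eq_zero_or_pos N with hN0 | hNpos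
    · rw [hN0]; simp; linarith [abs_nonneg (Real.log (Real.log (P.prime 0)))]
    · have hN1 : (0 : ℝ) < N := by exact_mod_cast hNpos
      have hlogN : Real.log N ≤ Real.log (Real.log x) - Real.log (Real.log (P.prime 0)) := by
        rw [← Real.log_div (by linarith) hlp.ne']
        exact Real.log_le_log hN1 hNle
      linarith [neg_abs_le (Real.log (Real.log (P.prime 0)))]
  -- tail: for `k ≥ N`, `π_P(y_k) = 0` and `0 ≤ F(y_k) ≤ W λ₀ log x/(k+1)`
  have htail_pt : ∀ k : ℕ, |d (k + N)| ≤ wBound R S M * P.prime 0 * Real.log x * (1 / (((k + N + 1 : ℕ) : ℝ)) ^ 2) := by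
    intro k
    have hk1 : (0 : ℝ) < (k : ℝ) + N + 1 := by positivity
    have hylt : y (k + N) < P.prime 0 := by
      have hlog : Real.log (y (k + N)) < Real.log (P.prime 0) := by
        rw [hlogy, div_lt_iff₀ (by push_cast; positivity)]
        calc Real.log x = Real.log x / Real.log (P.prime 0) * Real.log (P.prime 0) := by field_simp
          _ < ((N : ℝ) + 1) * Real.log (P.prime 0) := mul_lt_mul_of_pos_right hNlt hlp
          _ ≤ (((k + N : ℕ) : ℝ) + 1) * Real.log (P.prime 0) := by
              refine mul_le_mul_of_nonneg_right ?_ hlp.le; push_cast; linarith [(Nat.cast_nonneg k : (0:ℝ) ≤ k)]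
          _ = Real.log (P.prime 0) * (((k + N : ℕ) : ℝ) + 1) := by ring
      exact (Real.log_lt_log_iff (by linarith [hy1 (k + N)]) (by linarith)).mp hlog
    have hπ0 : P.primeCount (y (k + N)) = 0 := by
      rw [P.primeCount_eq_indexOf]; exact P.indexOf_eq_zero_of_lt_prime_zero hylt
    have hF : F R S δ M (y (k + N)) ≤ wBound R S M * P.prime 0 * Real.log x / (((k + N : ℕ) : ℝ) + 1) := by
      have h1 : F R S δ M (y (k + N)) ≤ wBound R S M * (y (k + N) * Real.log (y (k + N))) := h.F_le_mul_log (hy1 _)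
      rw [hlogy] at h1
      refine h1.trans ?_
      have h2 : y (k + N) * (Real.log x / (((k + N : ℕ) : ℝ) + 1)) ≤ P.prime 0 * (Real.log x / (((k + N : ℕ) : ℝ) + 1)) :=
        mul_le_mul_of_nonneg_right hylt.le (div_nonneg (by linarith) (by positivity))
      calc wBound R S M * (y (k + N) * (Real.log x / (((k + N : ℕ) : ℝ) + 1)))
          ≤ wBound R S M * (P.prime 0 * (Real.log x / (((k + N : ℕ) : ℝ) + 1))) := mul_le_mul_of_nonneg_left h2 hW.le
        _ = wBound R S M * P.prime 0 * Real.log x / (((k + N : ℕ) : ℝ) + 1) := by ring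
    simp only [hddef, hπ0, Nat.cast_zero, zero_sub, abs_div, abs_neg, abs_of_nonneg (h.F_nonneg (y (k + N)))]
    rw [abs_of_pos (by positivity : (0:ℝ) < ((k + N : ℕ) : ℝ) + 1), div_le_iff₀ (by positivity)]
    refine hF.trans (le_of_eq ?_)
    push_cast
    field_simp
  have hsum2 : Summable fun k : ℕ ↦ 1 / (((k + N + 1 : ℕ) : ℝ)) ^ 2 := by
    have := (summable_nat_add_iff (N + 1)).mpr (Real.summable_one_div_nat_pow.mpr one_lt_two)
    refine this.congr fun k ↦ ?_
    push_cast; ring_nf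
  have htail : |∑' k, d (k + N)| ≤ 2 * wBound R S M * P.prime 0 * Real.log (P.prime 0) := by
    have h1 : ‖∑' k, d (k + N)‖ ≤ ∑' k, wBound R S M * P.prime 0 * Real.log x * (1 / (((k + N + 1 : ℕ) : ℝ)) ^ 2) :=
      tsum_of_norm_bounded (hsum2.mul_left _).hasSum fun k ↦ by rw [Real.norm_eq_abs]; exact htail_pt k
    rw [Real.norm_eq_abs, tsum_mul_left] at h1
    refine h1.trans ?_
    have h2 := tsum_inv_sq_shift_le N
    have hlx0 : 0 ≤ wBound R S M * P.prime 0 * Real.log x := by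
      have : 0 ≤ P.prime 0 := by linarith
      positivity
    calc wBound R S M * P.prime 0 * Real.log x * ∑' k : ℕ, 1 / (((k + N + 1 : ℕ) : ℝ)) ^ 2
        ≤ wBound R S M * P.prime 0 * Real.log x * (2 / ((N : ℝ) + 1)) := mul_le_mul_of_nonneg_left h2 hlx0
      _ = 2 * wBound R S M * P.prime 0 * (Real.log x / ((N : ℝ) + 1)) := by ring
      _ ≤ 2 * wBound R S M * P.prime 0 * Real.log (P.prime 0) := by
          refine mul_le_mul_of_nonneg_left ?_ (by have : (0:ℝ) ≤ P.prime 0 := (by linarith); positivity)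
          rw [div_le_iff₀ (by positivity)]
          calc Real.log x = Real.log x / Real.log (P.prime 0) * Real.log (P.prime 0) := by field_simp
            _ ≤ ((N : ℝ) + 1) * Real.log (P.prime 0) := mul_le_mul_of_nonneg_right hNlt.le hlp.le
            _ = Real.log (P.prime 0) * ((N : ℝ) + 1) := by ring
  have hsplit : P.riemannPrimeCount x - G R S δ M x = ∑ k ∈ Finset.range N, d k + ∑' k, d (k + N) := by
    rw [← hd.tsum_eq]
    exact (hd.summable.sum_add_tsum_nat_add N).symm
  rw [hsplit]
  exact (abs_add_le _ _).trans (add_le_add hhead htail)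

/-- **`Π_P = G + O(log log x)`**: under `|π_P − F| ≤ A'` there is `C` with `|Π_P(x) − G(x)| ≤ C log log x` for
all `x ≥ 3`. [cite: BrouckeDebruyneRevesz2023, proof of Theorem 3.2 (3.2)] -/
theorem Adm.exists_abs_riemannPrimeCount_sub_G_le {A' : ℝ}
    (hπ : ∀ y : ℝ, 1 ≤ y → |(P.primeCount y : ℝ) - F R S δ M y| ≤ A') :
    ∃ C : ℝ, 0 ≤ C ∧ ∀ x : ℝ, 3 ≤ x → |P.riemannPrimeCount x - G R S δ M x| ≤ C * Real.log (Real.log x) := by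
  have hA' : 0 ≤ A' := le_trans (abs_nonneg _) (hπ 1 le_rfl)
  have hW := wBound_pos (R := R) (S := S) (M := M)
  set D : ℝ := A' * (1 + |Real.log (Real.log (P.prime 0))|) + 2 * wBound R S M * P.prime 0 * Real.log (P.prime 0)
    with hD
  have hl3 : 0 < Real.log (Real.log 3) := by
    refine Real.log_pos ?_
    rw [Real.lt_log_iff_exp_lt (by norm_num)]
    have := Real.exp_one_lt_d9; linarith
  have hD0 : 0 ≤ D := by
    have : 0 ≤ 2 * wBound R S M * P.prime 0 * Real.log (P.prime 0) := by
      have h1 : 0 ≤ P.prime 0 := by linarith [P.one_lt]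
      have h2 : 0 ≤ Real.log (P.prime 0) := Real.log_nonneg P.one_lt.le
      positivity
    exact add_nonneg (mul_nonneg hA' (by positivity)) this
  refine ⟨A' + D / Real.log (Real.log 3), by positivity, fun x hx ↦ ?_⟩
  have h1 := h.abs_riemannPrimeCount_sub_G_le P hπ hx
  have hll : Real.log (Real.log 3) ≤ Real.log (Real.log x) :=
    Real.log_le_log (Real.log_pos (by norm_num)) (Real.log_le_log (by norm_num) hx)
  have hD' : D ≤ D / Real.log (Real.log 3) * Real.log (Real.log x) := by
    rw [div_mul_eq_mul_div, le_div_iff₀ hl3]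
    exact mul_le_mul_of_nonneg_left hll hD0
  calc |P.riemannPrimeCount x - G R S δ M x|
      ≤ A' * (1 + Real.log (Real.log x) + |Real.log (Real.log (P.prime 0))|) +
          2 * wBound R S M * P.prime 0 * Real.log (P.prime 0) := h1
    _ = A' * Real.log (Real.log x) + D := by rw [hD]; ring
    _ ≤ A' * Real.log (Real.log x) + D / Real.log (Real.log 3) * Real.log (Real.log x) := by linarith
    _ = (A' + D / Real.log (Real.log 3)) * Real.log (Real.log x) := by ring

/-- The bound in the monotone form used for `ψ`: with `E(x) = (Π_P(3) + G(3)) + C log x`,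
`|Π_P(u) − G(u)| ≤ E(x)` for `1 ≤ u ≤ x` (on `[1,3]` both functions are monotone and non-negative; on
`[3, ∞)`, `log log u ≤ log u ≤ log x`). [cite: BrouckeDebruyneRevesz2023, proof of Theorem 3.2] -/
theorem Adm.abs_riemannPrimeCount_sub_G_le_unif {C : ℝ} (hC : 0 ≤ C)
    (hPi : ∀ x : ℝ, 3 ≤ x → |P.riemannPrimeCount x - G R S δ M x| ≤ C * Real.log (Real.log x))
    {u x : ℝ} (hu : 1 ≤ u) (hux : u ≤ x) :
    |P.riemannPrimeCount u - G R S δ M u| ≤ (P.riemannPrimeCount 3 + G R S δ M 3) + C * Real.log x := by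
  have hlogx : 0 ≤ Real.log x := Real.log_nonneg (hu.trans hux)
  have hE0 : 0 ≤ P.riemannPrimeCount 3 + G R S δ M 3 := add_nonneg (P.riemannPrimeCount_nonneg 3) (h.G_nonneg 3)
  rcases le_or_gt u 3 with hu3 | hu3
  · have h1 : |P.riemannPrimeCount u - G R S δ M u| ≤ P.riemannPrimeCount 3 + G R S δ M 3 := by
      rw [abs_le]
      have := P.riemannPrimeCount_nonneg u
      have := P.riemannPrimeCount_mono hu3
      have := h.G_nonneg u
      have := h.G_mono hu3
      constructor <;> linarith
    nlinarith
  · have hu0 : 0 < u := by linarith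
    have hlu : 1 < Real.log u := by
      rw [Real.lt_log_iff_exp_lt hu0]
      exact lt_trans (by have := Real.exp_one_lt_d9; linarith) hu3
    have h1 := hPi u hu3.le
    have h2 : Real.log (Real.log u) ≤ Real.log x :=
      (Real.log_le_sub_one_of_pos (by linarith)).trans (by linarith [Real.log_le_log hu0 hux])
    nlinarith [mul_le_mul_of_nonneg_left h2 hC]


/-! ### `∫₁ˣ log u dG(u)` -/

omit h in
/-- The real closed form of `g`: for `u > 1`,
`g(u) = ((u − 1) + Σ_ω (u^ω − 1) − Σ_ρ (u^ρ − 1) + M(u^δ − 1))/(u log u)`.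
[cite: BrouckeDebruyneRevesz2023, proof of Theorem 3.2 (3.3), (2.5)] -/
theorem g_eq_sum_real {u : ℝ} (hu : 1 < u) :
    g R S δ M u = ((u ^ (1 : ℝ) - 1) + ∑ ω ∈ S, (u ^ ω - 1) - ∑ ρ ∈ R, (u ^ ρ - 1) + M * (u ^ δ - 1)) /
      Real.log u * u⁻¹ := by
  set L := Real.log u with hLdef
  have hL : 0 < L := Real.log_pos hu
  have hterm : ∀ n : ℕ, GCoeff R S δ M (n + 1) * L ^ n / (n ! : ℝ) =
      LiCoeff (n + 1) * (1 : ℝ) ^ (n + 1) * L ^ n / (n ! : ℝ) +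
        (∑ ω ∈ S, LiCoeff (n + 1) * ω ^ (n + 1) * L ^ n / (n ! : ℝ)) -
        (∑ ρ ∈ R, LiCoeff (n + 1) * ρ ^ (n + 1) * L ^ n / (n ! : ℝ)) +
        (M : ℝ) * (LiCoeff (n + 1) * δ ^ (n + 1) * L ^ n / (n ! : ℝ)) := by
    intro n
    simp only [GCoeff, tmplWeight, one_pow, mul_one, ← Finset.sum_div, ← Finset.sum_mul, ← Finset.mul_sum]
    ring
  have hsum : HasSum (fun n : ℕ ↦ GCoeff R S δ M (n + 1) * L ^ n / n !)
      ((u ^ (1 : ℝ) - 1) / L + ∑ ω ∈ S, (u ^ ω - 1) / L - ∑ ρ ∈ R, (u ^ ρ - 1) / L + (M : ℝ) * ((u ^ δ - 1) / L)) := by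
    simp_rw [hterm]
    exact (((hasSum_LiCoeff_pow hu 1).add (hasSum_sum fun ω _ ↦ hasSum_LiCoeff_pow hu ω)).sub
      (hasSum_sum fun ρ _ ↦ hasSum_LiCoeff_pow hu ρ)).add ((hasSum_LiCoeff_pow hu δ).mul_left (M : ℝ))
  rw [g_of_one_lt hu, logSeries, hsum.tsum_eq]
  congr 1
  simp only [add_div, sub_div, Finset.sum_div]
  ring

omit h in
/-- `Λ_r(x) = (x^r − 1)/r − log x = ∫₁ˣ log u dLi(u^r)`, with derivative `(x^r − 1)/x`.
[cite: BrouckeDebruyneRevesz2023, proof of Theorem 3.2] -/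
theorem hasDerivAt_lambdaTerm {r y : ℝ} (hr : r ≠ 0) (hy : 0 < y) :
    HasDerivAt (fun y : ℝ ↦ (y ^ r - 1) / r - Real.log y) ((y ^ r - 1) * y⁻¹) y := by
  have h1 : HasDerivAt (fun y : ℝ ↦ y ^ r) (r * y ^ (r - 1)) y := Real.hasDerivAt_rpow_const (Or.inl hy.ne')
  have h2 : HasDerivAt Real.log y⁻¹ y := Real.hasDerivAt_log hy.ne'
  have h3 : HasDerivAt (fun y : ℝ ↦ (y ^ r - 1) / r - Real.log y) (r * y ^ (r - 1) / r - y⁻¹) y :=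
    ((h1.sub_const 1).div_const r).fun_sub h2
  refine h3.congr_deriv ?_
  rw [Real.rpow_sub_one hy.ne']
  field_simp

/-- `u ↦ G u / u` is continuous on `[1, X]`. [folklore] -/
theorem Adm.continuousOn_G_div (X : ℝ) : ContinuousOn (fun u ↦ G R S δ M u / u) (Icc 1 X) :=
  h.continuous_G.continuousOn.div continuousOn_id fun _ hu ↦ ne_of_gt (lt_of_lt_of_le one_pos hu.1)

/-- `u ↦ G u / u` is interval integrable on `[1, x]`. [folklore] -/
theorem Adm.intervalIntegrable_G_div {x : ℝ} (hx : 1 ≤ x) :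
    IntervalIntegrable (fun u ↦ G R S δ M u / u) volume 1 x := by
  refine ContinuousOn.intervalIntegrable ?_
  rw [uIcc_of_le hx]
  exact h.continuousOn_G_div x

/-- **`∫₁ˣ log u dG(u)`**: for `x ≥ 1`,
`G(x) log x − ∫₁ˣ G(u) du/u = Λ₁(x) + Σ_ω Λ_ω(x) − Σ_ρ Λ_ρ(x) + M Λ_δ(x)`, `Λ_r(x) = (x^r − 1)/r − log x`
("`∫_1^x log u dLi(u^z) = (x^z − 1)/z − log x`"), by the mean value theorem: both sides vanish at `1` and have the
same derivative `g(y) log y` on `(1, x)`. [cite: BrouckeDebruyneRevesz2023, proof of Theorem 3.2] -/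
theorem Adm.G_mul_log_sub_integral {x : ℝ} (hx : 1 ≤ x) :
    G R S δ M x * Real.log x - ∫ u in (1 : ℝ)..x, G R S δ M u / u =
      ((x ^ (1 : ℝ) - 1) / 1 - Real.log x) + ∑ ω ∈ S, ((x ^ ω - 1) / ω - Real.log x) -
        ∑ ρ ∈ R, ((x ^ ρ - 1) / ρ - Real.log x) + M * ((x ^ δ - 1) / δ - Real.log x) := by
  rcases hx.eq_or_lt with h1 | h1
  · rw [← h1]; simp [G_one]
  -- the right-hand side as a function and its derivative
  set Λ : ℝ → ℝ → ℝ := fun r y ↦ (y ^ r - 1) / r - Real.log y with hΛ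
  set Rhs : ℝ → ℝ := fun y ↦ Λ 1 y + ∑ ω ∈ S, Λ ω y - ∑ ρ ∈ R, Λ ρ y + M * Λ δ y with hRhs
  have hRhs_deriv : ∀ y : ℝ, 0 < y → HasDerivAt Rhs
      (((y ^ (1 : ℝ) - 1) + ∑ ω ∈ S, (y ^ ω - 1) - ∑ ρ ∈ R, (y ^ ρ - 1) + M * (y ^ δ - 1)) * y⁻¹) y := by
    intro y hy
    have hd : ∀ {r : ℝ}, r ≠ 0 → HasDerivAt (Λ r) ((y ^ r - 1) * y⁻¹) y := fun hr ↦ hasDerivAt_lambdaTerm hr hy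
    have hS' : ∀ ω ∈ S, HasDerivAt (Λ ω) ((y ^ ω - 1) * y⁻¹) y := fun ω hω ↦ hd (h.hS ω hω).1.ne'
    have hR' : ∀ ρ ∈ R, HasDerivAt (Λ ρ) ((y ^ ρ - 1) * y⁻¹) y := fun ρ hρ ↦ hd (h.hR ρ hρ).1.ne'
    have h4 : HasDerivAt Rhs ((y ^ (1 : ℝ) - 1) * y⁻¹ + ∑ ω ∈ S, (y ^ ω - 1) * y⁻¹ - ∑ ρ ∈ R, (y ^ ρ - 1) * y⁻¹ +
        (M : ℝ) * ((y ^ δ - 1) * y⁻¹)) y :=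
      (((hd one_ne_zero).fun_add (HasDerivAt.fun_sum hS')).fun_sub (HasDerivAt.fun_sum hR')).fun_add
        ((hd h.hδ0.ne').const_mul (M : ℝ))
    refine h4.congr_deriv ?_
    simp only [add_mul, sub_mul, Finset.sum_mul]
    ring
  set Φ : ℝ → ℝ := fun y ↦ G R S δ M y * Real.log y - (∫ u in (1 : ℝ)..y, G R S δ M u / u) - Rhs y with hΦ
  have hlog : ContinuousOn Real.log (Icc 1 x) :=
    Real.continuousOn_log.mono fun u hu ↦ ne_of_gt (lt_of_lt_of_le one_pos hu.1)
  have hΛc : ∀ r : ℝ, ContinuousOn (Λ r) (Icc 1 x) := by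
    intro r
    refine ((ContinuousOn.sub ?_ continuousOn_const).div_const r).sub hlog
    exact ContinuousOn.rpow_const continuousOn_id fun u hu ↦ Or.inl (ne_of_gt (lt_of_lt_of_le one_pos hu.1))
  have hRhsc : ContinuousOn Rhs (Icc 1 x) := by
    refine (((hΛc 1).add (continuousOn_finsetSum S fun ω _ ↦ hΛc ω)).sub
      (continuousOn_finsetSum R fun ρ _ ↦ hΛc ρ)).add (continuousOn_const.mul (hΛc δ))
  have hΦc : ContinuousOn Φ (Icc 1 x) := by
    refine ((h.continuous_G.continuousOn.mul hlog).sub ?_).sub hRhsc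
    have h2 := intervalIntegral.continuousOn_primitive_interval' (h.intervalIntegrable_G_div hx)
      (show (1 : ℝ) ∈ uIcc 1 x from left_mem_uIcc)
    rw [uIcc_of_le hx] at h2
    exact h2
  have hΦd : ∀ y ∈ Ioo 1 x, HasDerivAt Φ 0 y := by
    intro y hy
    have hy0 : 0 < y := lt_trans one_pos hy.1
    have hL : Real.log y ≠ 0 := (Real.log_pos hy.1).ne'
    have hd1 : HasDerivAt (G R S δ M) (g R S δ M y) y := h.hasDerivAt_G hy.1
    have hd2 : HasDerivAt Real.log y⁻¹ y := Real.hasDerivAt_log hy0.ne'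
    have hd3 : HasDerivAt (fun z ↦ ∫ u in (1 : ℝ)..z, G R S δ M u / u) (G R S δ M y / y) y := by
      have hco : ContinuousOn (fun u ↦ G R S δ M u / u) (Ioo 1 x) := (h.continuousOn_G_div x).mono Ioo_subset_Icc_self
      exact intervalIntegral.integral_hasDerivAt_right (h.intervalIntegrable_G_div hy.1.le)
        (hco.stronglyMeasurableAtFilter (μ := volume) isOpen_Ioo y hy) (hco.continuousAt (Ioo_mem_nhds hy.1 hy.2))
    have hd4 : HasDerivAt Φ (g R S δ M y * Real.log y + G R S δ M y * y⁻¹ - G R S δ M y / y -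
        ((y ^ (1 : ℝ) - 1) + ∑ ω ∈ S, (y ^ ω - 1) - ∑ ρ ∈ R, (y ^ ρ - 1) + M * (y ^ δ - 1)) * y⁻¹) y :=
      ((hd1.fun_mul hd2).fun_sub hd3).fun_sub (hRhs_deriv y hy0)
    refine hd4.congr_deriv ?_
    rw [g_eq_sum_real hy.1]
    field_simp
    ring
  obtain ⟨c, _, hc⟩ := exists_hasDerivAt_eq_slope Φ (fun _ ↦ 0) h1 hΦc hΦd
  have hΦ1 : Φ 1 = 0 := by simp [hΦ, hRhs, hΛ, G_one]
  have hΦx : Φ x = 0 := by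
    rw [eq_comm, div_eq_iff (show x - 1 ≠ 0 by linarith), zero_mul] at hc
    linarith
  have := hΦx
  simp only [hΦ, hRhs, hΛ, sub_eq_zero] at this
  rw [this]

/-! ### The first assertion of Theorem 3.2 -/

/-- `ψ_P(x) − ∫₁ˣ log u dG(u) = (Π_P − G)(x) log x − ∫₁ˣ (Π_P − G)(u) du/u` (`x ≥ 1`).
[cite: BrouckeDebruyneRevesz2023, proof of Theorem 3.2] -/
theorem Adm.chebyshevPsi_sub_eq {x : ℝ} (hx : 1 ≤ x) :
    P.chebyshevPsi x - (G R S δ M x * Real.log x - ∫ u in (1 : ℝ)..x, G R S δ M u / u) =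
      (P.riemannPrimeCount x - G R S δ M x) * Real.log x -
        ∫ u in (1 : ℝ)..x, (P.riemannPrimeCount u - G R S δ M u) / u := by
  rw [P.chebyshevPsi_eq_riemannPrimeCount_mul_log_sub_integral hx]
  have h1 : ∫ u in (1 : ℝ)..x, (P.riemannPrimeCount u - G R S δ M u) / u
      = (∫ u in (1 : ℝ)..x, P.riemannPrimeCount u / u) - ∫ u in (1 : ℝ)..x, G R S δ M u / u := by
    simp_rw [sub_div]
    exact intervalIntegral.integral_sub (P.intervalIntegrable_riemannPrimeCount_div hx) (h.intervalIntegrable_G_div hx)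
  rw [h1]
  ring

omit h in
/-- Elementary: `(log x)² ≤ (4/δ²) x^δ` for `x ≥ 1`, `δ > 0` (`log x ≤ x^{δ/2}/(δ/2)`). [folklore] -/
theorem log_sq_le {x d : ℝ} (hx : 1 ≤ x) (hd : 0 < d) : Real.log x ^ 2 ≤ 4 / d ^ 2 * x ^ d := by
  have h1 : Real.log x ≤ x ^ (d / 2) / (d / 2) := Real.log_le_rpow_div (by linarith) (by positivity)
  have h0 : 0 ≤ Real.log x := Real.log_nonneg hx
  have h2 : Real.log x ^ 2 ≤ (x ^ (d / 2) / (d / 2)) ^ 2 := pow_le_pow_left₀ h0 h1 2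
  refine h2.trans (le_of_eq ?_)
  rw [div_pow, ← Real.rpow_natCast (x ^ (d / 2)) 2, ← Real.rpow_mul (by linarith)]
  norm_num
  field_simp
  norm_num

/-- **BDR Theorem 3.2, first assertion.** If `|π_P(y) − F(y)| ≤ A'` for `y ≥ 1`, then there is `C` such that for
all `x ≥ 1`, `|ψ_P(x) − (x + Σ_{ω∈S} x^ω/ω − Σ_{ρ∈R} x^ρ/ρ)| ≤ C x^δ`: indeed
`ψ_P(x) = x + Σ_ω x^ω/ω − Σ_ρ x^ρ/ρ + M x^δ/δ − c₀ − (1 + |S| − |R| + M) log x + O(log x · (1 + log x))`,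
and `log x ≤ x^δ/δ`, `(log x)² ≤ 4x^δ/δ²`. [cite: BrouckeDebruyneRevesz2023, Theorem 3.2 (first assertion)] -/
theorem Adm.exists_abs_chebyshevPsi_sub_le {A' : ℝ}
    (hπ : ∀ y : ℝ, 1 ≤ y → |(P.primeCount y : ℝ) - F R S δ M y| ≤ A') :
    ∃ C : ℝ, ∀ x : ℝ, 1 ≤ x →
      |P.chebyshevPsi x - (x + ∑ ω ∈ S, x ^ ω / ω - ∑ ρ ∈ R, x ^ ρ / ρ)| ≤ C * x ^ δ := by
  obtain ⟨C, hC0, hC⟩ := h.exists_abs_riemannPrimeCount_sub_G_le P hπ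
  have hδ := h.hδ0
  set E₀ : ℝ := P.riemannPrimeCount 3 + G R S δ M 3 with hE₀
  have hE₀0 : 0 ≤ E₀ := add_nonneg (P.riemannPrimeCount_nonneg 3) (h.G_nonneg 3)
  -- the constants of the main-term bookkeeping
  set c₀ : ℝ := 1 + ∑ ω ∈ S, 1 / ω - ∑ ρ ∈ R, 1 / ρ + M / δ with hc₀
  set W₁ : ℝ := 1 + S.card - R.card + M with hW₁
  refine ⟨M / δ + |c₀| + |W₁| / δ + 2 * E₀ / δ + 8 * C / δ ^ 2, fun x hx ↦ ?_⟩
  have hx0 : 0 < x := by linarith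
  have hL0 : 0 ≤ Real.log x := Real.log_nonneg hx
  have hxδ : 1 ≤ x ^ δ := Real.one_le_rpow hx hδ.le
  have hxδ0 : 0 < x ^ δ := by linarith
  have hlog1 : Real.log x ≤ x ^ δ / δ := Real.log_le_rpow_div hx0.le hδ
  have hlog2 : Real.log x ^ 2 ≤ 4 / δ ^ 2 * x ^ δ := log_sq_le hx hδ
  -- the identity for the main term
  have hmain : G R S δ M x * Real.log x - ∫ u in (1 : ℝ)..x, G R S δ M u / u =
      (x + ∑ ω ∈ S, x ^ ω / ω - ∑ ρ ∈ R, x ^ ρ / ρ) + M * x ^ δ / δ - c₀ - W₁ * Real.log x := by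
    rw [h.G_mul_log_sub_integral hx, Real.rpow_one]
    simp only [hc₀, hW₁, Finset.sum_sub_distrib, Finset.sum_const, nsmul_eq_mul, sub_div]
    field_simp
    ring
  -- the two error pieces
  have hE : ∀ u : ℝ, 1 ≤ u → u ≤ x → |P.riemannPrimeCount u - G R S δ M u| ≤ E₀ + C * Real.log x :=
    fun u hu hux ↦ h.abs_riemannPrimeCount_sub_G_le_unif P hC0 hC hu hux
  have hEx : 0 ≤ E₀ + C * Real.log x := by positivity
  have herr1 : |(P.riemannPrimeCount x - G R S δ M x) * Real.log x| ≤ (E₀ + C * Real.log x) * Real.log x := by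
    rw [abs_mul, abs_of_nonneg hL0]
    exact mul_le_mul_of_nonneg_right (hE x hx le_rfl) hL0
  have herr2 : |∫ u in (1 : ℝ)..x, (P.riemannPrimeCount u - G R S δ M u) / u| ≤ (E₀ + C * Real.log x) * Real.log x := by
    have hb : ∀ᵐ u : ℝ, u ∈ Ioc (1 : ℝ) x → ‖(P.riemannPrimeCount u - G R S δ M u) / u‖ ≤ (E₀ + C * Real.log x) * u⁻¹ := by
      refine Eventually.of_forall fun u hu ↦ ?_
      have hu0 : 0 < u := by linarith [hu.1]
      rw [Real.norm_eq_abs, abs_div, abs_of_pos hu0, div_eq_mul_inv]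
      exact mul_le_mul_of_nonneg_right (hE u hu.1.le hu.2) (inv_nonneg.mpr hu0.le)
    have hinv : IntervalIntegrable (fun u : ℝ ↦ (E₀ + C * Real.log x) * u⁻¹) volume 1 x := by
      refine ContinuousOn.intervalIntegrable ?_
      rw [uIcc_of_le hx]
      exact continuousOn_const.mul (continuousOn_inv₀.mono fun u hu ↦ ne_of_gt (by linarith [hu.1]))
    have h1 := intervalIntegral.norm_integral_le_of_norm_le hx hb hinv
    have h0 : (0 : ℝ) ∉ uIcc 1 x := by rw [uIcc_of_le hx]; exact fun hh ↦ by linarith [hh.1]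
    rw [intervalIntegral.integral_const_mul, integral_inv h0, div_one, Real.norm_eq_abs] at h1
    exact h1
  -- assemble
  have hid := h.chebyshevPsi_sub_eq P hx
  rw [hmain] at hid
  have e : P.chebyshevPsi x - (x + ∑ ω ∈ S, x ^ ω / ω - ∑ ρ ∈ R, x ^ ρ / ρ) =
      (M * x ^ δ / δ - c₀ - W₁ * Real.log x) +
        ((P.riemannPrimeCount x - G R S δ M x) * Real.log x -
          ∫ u in (1 : ℝ)..x, (P.riemannPrimeCount u - G R S δ M u) / u) := by linarith
  rw [e]
  have hM0 : (0 : ℝ) ≤ M := Nat.cast_nonneg M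
  calc |M * x ^ δ / δ - c₀ - W₁ * Real.log x +
        ((P.riemannPrimeCount x - G R S δ M x) * Real.log x -
          ∫ u in (1 : ℝ)..x, (P.riemannPrimeCount u - G R S δ M u) / u)|
      ≤ |M * x ^ δ / δ - c₀ - W₁ * Real.log x| +
          |(P.riemannPrimeCount x - G R S δ M x) * Real.log x -
            ∫ u in (1 : ℝ)..x, (P.riemannPrimeCount u - G R S δ M u) / u| := abs_add_le _ _
    _ ≤ (M * x ^ δ / δ + |c₀| + |W₁| * Real.log x) + 2 * ((E₀ + C * Real.log x) * Real.log x) := by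
        gcongr
        · calc |M * x ^ δ / δ - c₀ - W₁ * Real.log x| ≤ |M * x ^ δ / δ - c₀| + |W₁ * Real.log x| := abs_sub _ _
            _ ≤ (|M * x ^ δ / δ| + |c₀|) + |W₁| * Real.log x := by
                rw [abs_mul W₁, abs_of_nonneg hL0]; exact add_le_add (abs_sub _ _) le_rfl
            _ = M * x ^ δ / δ + |c₀| + |W₁| * Real.log x := by rw [abs_of_nonneg (by positivity)]
        · calc _ ≤ |(P.riemannPrimeCount x - G R S δ M x) * Real.log x| +
              |∫ u in (1 : ℝ)..x, (P.riemannPrimeCount u - G R S δ M u) / u| := abs_sub _ _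
            _ ≤ _ := by linarith [herr1, herr2]
    _ ≤ (M / δ + |c₀| + |W₁| / δ + 2 * E₀ / δ + 8 * C / δ ^ 2) * x ^ δ := by
        have h1 : |c₀| ≤ |c₀| * x ^ δ := le_mul_of_one_le_right (abs_nonneg _) hxδ
        have h2 : |W₁| * Real.log x ≤ |W₁| / δ * x ^ δ := by
          calc |W₁| * Real.log x ≤ |W₁| * (x ^ δ / δ) := mul_le_mul_of_nonneg_left hlog1 (abs_nonneg _)
            _ = |W₁| / δ * x ^ δ := by ring
        have h3 : 2 * ((E₀ + C * Real.log x) * Real.log x) ≤ (2 * E₀ / δ + 8 * C / δ ^ 2) * x ^ δ := by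
          have h31 : E₀ * Real.log x ≤ E₀ * (x ^ δ / δ) := mul_le_mul_of_nonneg_left hlog1 hE₀0
          have h32 : C * Real.log x ^ 2 ≤ C * (4 / δ ^ 2 * x ^ δ) := mul_le_mul_of_nonneg_left hlog2 hC0
          have e1 : (2 * E₀ / δ + 8 * C / δ ^ 2) * x ^ δ = 2 * (E₀ * (x ^ δ / δ)) + 2 * (C * (4 / δ ^ 2 * x ^ δ)) := by
            ring
          have e2 : 2 * ((E₀ + C * Real.log x) * Real.log x) = 2 * (E₀ * Real.log x) + 2 * (C * Real.log x ^ 2) := by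
            ring
          rw [e1, e2]
          linarith
        have h4 : (M / δ + |c₀| + |W₁| / δ + 2 * E₀ / δ + 8 * C / δ ^ 2) * x ^ δ =
            M * x ^ δ / δ + |c₀| * x ^ δ + |W₁| / δ * x ^ δ + (2 * E₀ / δ + 8 * C / δ ^ 2) * x ^ δ := by ring
        rw [h4]
        linarith

end BDR

end Literature.NumberTheory.BeurlingPrimes
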